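import Summits.QuantumFields.YangMills.Theorems.BalabanUVNodesN21FineTestJunction

/-!
# YM-DAG node N21 (= NE7c) — THE SLOT-LEVEL JUNCTION: the (2.17) small-field SLOT tests a `sup` over the plaquettes of a
# cube; two finite families that are `δ`-close along maps in BOTH directions have `δ`-close suprema, so run A's slot variable
# `max_{p ⊂ □} ‖U_A(∂p) − 1‖` and run B's OWN slot variable `max_{p₀ ⊂ □} L²‖U_B(∂p₀) − 1‖` (block-aligned cube) are
# `(C_Qθ^{13k} + E_{k+1})`-close, and the four mismatch pieces of the two runs' SLOT indicators lie in single-run shells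

Track A of `YM-PLAN.md` (cell `pub-ymgap`, HUMAN RULING D-0062), node **N21**; seat `pub-ymgap-dag-n21-a`, generation 3, file 7 (over
file 6 `BalabanUVNodesN21FineTestJunction`).  `--supports stmt-QuantumFields-19182`.  Kernel bookkeeping BY NAME: 0 `def`, 0 `sorry`,
standard axioms.  COUNT-NEUTRAL.

HONEST FRAMING.  NE7c NOT PRINTED ∕ NOT PROVED; N16 (`hcov`) and the sup-regularity of run B's minimiser (`hsup : RegularSup …`) are
HYPOTHESES exactly as in file 6.  What is added is the finite bookkeeping that file 3 (b) and file 6 left to the term object: the slot test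
of [Balaban1988Convergent] (2.17) p. 257 — *"χ_k(Ω_k) = ∏_{□⊂Ω_k} χ({sup_{p⊂□∼} |U_{k,□}(V_k, ∂p) − 1| < ε_kη²})"* — reads the `sup` of
the plaquette deviations over a cube; for a BLOCK-ALIGNED cube (the fine cube is the union of the `L`-blocks of the coarse cube: every
fine plaquette's block partner is a coarse plaquette of the cube, every coarse plaquette's block corner is a fine plaquette of the cube —
Bałaban's cubes are unions of blocks, p. 257 *"This partition is compatible with all other partitions of this lattice"*) the two runs'
slot variables are as close as the plaquette variables.  Which cubes, thresholds and backgrounds are «of record» is NODE O's; here the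
cube is ANY pair of finite plaquette sets with the two maps.  One finite four-torus at fixed `ε`; NOT continuum ∕ ℝ⁴ ∕ OS ∕ mass gap ∕ Clay.

CITATION HEADER (lean-in-tree rule 2026-08-18).  BY NAME: file 6's `abs_devA_sub_scaledFine_le_of_n16` (with its binder list) and
`exists_block_decomp`; `T4IndicatorShell` §3 (`smallInd_mul_one_sub_le`, `largeInd_mul_one_sub_le`, `abs_sub_comm_le`); Mathlib's
`Finset.sup'`.  Context only: [Balaban1988Convergent] (2.17) p. 257 (quoted above from the tree's `T4IndicatorShell` header).  No printed
sentence is a hypothesis of any declaration.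

WHAT IS PROVED ([folklore]).
* §1 `abs_sup'_sub_sup'_le`: finite families `a` on `I`, `b` on `J` with maps `σ : I → J`, `π : J → I` and `a i ≤ b(σ i) + δ`,
  `b j ≤ a(π j) + δ` have `|sup_I a − sup_J b| ≤ δ`; `smallInd_sup'_scaled` (run B's slot test `sup u^B < t∕L²` IS `sup (L²u^B) < t`).
* §2 `slot_shell_domination`: hence the four mismatch pieces of the SLOT indicators `χ_t(sup_I a)`, `ζ_t(sup_I a)` vs `χ_t(sup_J b)`,
  `ζ_t(sup_J b)` lie in single-run shells of width `δ` (`T4IndicatorShell` §3 BY NAME).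
* §3 `abs_slotA_sub_slotB_le_of_n16` (d = 4): under file 6's hypotheses, for a block-aligned pair (`I` coarse corners, `J` fine corners,
  `L·I ⊆ J`, block partners of `J` in `I`) and a plane `π`: `|max_{x∈I} ‖U_A(∂p_x) − 1‖ − max_{w∈J} L²‖U_B(∂p_w) − 1‖| ≤ C_Qθ^{13k} + E_{k+1}`;
  `slot_shell_domination_of_n16`: the four slot-level mismatch pieces AT RUN B's OWN SLOT TEST in single-run shells of that width.
-/

set_option autoImplicit false

noncomputable section

open scoped BigOperators Matrix Matrix.Norms.L2Operator

namespace Summit.QuantumFields.YangMills.Theorems.N21SlotSupJunction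

open Literature.MathematicalPhysics.QuantumFieldTheory.Balaban1983to89
open B7Prop1Explicit B7Prop2Explicit
open T4IndicatorShell (smallInd largeInd shellBelow shellAbove smallInd_mul_one_sub_le largeInd_mul_one_sub_le
  abs_sub_comm_le)
open T4AveragingDeficitWall (Plane)
open Summit.QuantumFields.BalabanUV.T4Continuum
open MinimalActionSandwich (IsMinimiser)
open MinimalActionRate (Regular)
open MinimalActionRefine (RegularSup)
open NE3EnergyWeightedCovShape (NE3EnergyRateWCov)
open AveragingDeficitDualResidual (dualC1 dualC2)
open AveragingDeficitDerivWallProof (wallConst)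
open N21FineTestJunction (abs_devA_sub_scaledFine_le_of_n16 exists_block_decomp)

/-! ## §1 Suprema of two finite families close along maps in both directions -/

/-- **CLOSE FAMILIES HAVE CLOSE SUPREMA.**  If every `a i` (`i ∈ I`) is within `δ` ABOVE some `b`-value (`a i ≤ b(σ i) + δ`, `σ i ∈ J`)
and every `b j` (`j ∈ J`) within `δ` above some `a`-value (`b j ≤ a(π j) + δ`, `π j ∈ I`), then `|sup_I a − sup_J b| ≤ δ`. [folklore] -/
theorem abs_sup'_sub_sup'_le {ι κ : Type*} {I : Finset ι} {J : Finset κ} (hI : I.Nonempty) (hJ : J.Nonempty)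
    (a : ι → ℝ) (b : κ → ℝ) {δ : ℝ} (σ : ι → κ) (hσ : ∀ i ∈ I, σ i ∈ J) (hσc : ∀ i ∈ I, a i ≤ b (σ i) + δ)
    (π : κ → ι) (hπ : ∀ j ∈ J, π j ∈ I) (hπc : ∀ j ∈ J, b j ≤ a (π j) + δ) :
    |I.sup' hI a - J.sup' hJ b| ≤ δ := by
  rw [abs_sub_le_iff]
  constructor
  · have h : I.sup' hI a ≤ J.sup' hJ b + δ := Finset.sup'_le hI a fun i hi => by
      have h1 : b (σ i) ≤ J.sup' hJ b := Finset.le_sup' b (hσ i hi)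
      linarith [hσc i hi]
    linarith
  · have h : J.sup' hJ b ≤ I.sup' hI a + δ := Finset.sup'_le hJ b fun j hj => by
      have h1 : a (π j) ≤ I.sup' hI a := Finset.le_sup' a (hπ j hj)
      linarith [hπc j hj]
    linarith

/-- Run B's own SLOT test at the fine threshold, `sup_J u < t∕c`, IS the test `sup_J (c·u) < t` of the rescaled family (`c > 0`). [folklore] -/
theorem smallInd_sup'_scaled {κ : Type*} {J : Finset κ} (hJ : J.Nonempty) (u : κ → ℝ) {c t : ℝ} (hc : 0 < c) :
    smallInd (J.sup' hJ u) (t / c) = smallInd (J.sup' hJ fun j => c * u j) t := by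
  unfold smallInd
  have e : (J.sup' hJ u < t / c) ↔ (J.sup' hJ (fun j => c * u j) < t) := by
    rw [Finset.sup'_lt_iff, Finset.sup'_lt_iff]
    refine forall₂_congr fun j _ => ?_
    rw [lt_div_iff₀ hc, mul_comm]
  simp only [e]

/-- … and the same for the large-field slot test `ζ`. [folklore] -/
theorem largeInd_sup'_scaled {κ : Type*} {J : Finset κ} (hJ : J.Nonempty) (u : κ → ℝ) {c t : ℝ} (hc : 0 < c) :
    largeInd (J.sup' hJ u) (t / c) = largeInd (J.sup' hJ fun j => c * u j) t := by
  unfold largeInd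
  have e : (t / c ≤ J.sup' hJ u) ↔ (t ≤ J.sup' hJ (fun j => c * u j)) := by
    rw [← not_lt, ← not_lt, Finset.sup'_lt_iff, Finset.sup'_lt_iff, not_iff_not]
    refine forall₂_congr fun j _ => ?_
    rw [lt_div_iff₀ hc, mul_comm]
  simp only [e]

/-! ## §2 The four mismatch pieces of the SLOT indicators -/

/-- **SLOT-LEVEL SHELL DOMINATION (abstract).**  Under the two-way closeness of §1, the four mismatch pieces of the slot indicators
`χ_t(sup_I a)`, `ζ_t(sup_I a)` against `χ_t(sup_J b)`, `ζ_t(sup_J b)` lie in the single-run shells of width `δ` of the respective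
`sup` variable (`T4IndicatorShell.smallInd_mul_one_sub_le` ∕ `largeInd_mul_one_sub_le`). [folklore] -/
theorem slot_shell_domination {ι κ : Type*} {I : Finset ι} {J : Finset κ} (hI : I.Nonempty) (hJ : J.Nonempty)
    (a : ι → ℝ) (b : κ → ℝ) {δ : ℝ} (σ : ι → κ) (hσ : ∀ i ∈ I, σ i ∈ J) (hσc : ∀ i ∈ I, a i ≤ b (σ i) + δ)
    (π : κ → ι) (hπ : ∀ j ∈ J, π j ∈ I) (hπc : ∀ j ∈ J, b j ≤ a (π j) + δ) (t : ℝ) :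
    smallInd (I.sup' hI a) t * (1 - smallInd (J.sup' hJ b) t) ≤ shellBelow (I.sup' hI a) t δ ∧
      smallInd (J.sup' hJ b) t * (1 - smallInd (I.sup' hI a) t) ≤ shellBelow (J.sup' hJ b) t δ ∧
      largeInd (I.sup' hI a) t * (1 - largeInd (J.sup' hJ b) t) ≤ shellAbove (I.sup' hI a) t δ ∧
      largeInd (J.sup' hJ b) t * (1 - largeInd (I.sup' hI a) t) ≤ shellAbove (J.sup' hJ b) t δ := by
  have h := abs_sup'_sub_sup'_le hI hJ a b σ hσ hσc π hπ hπc
  exact ⟨smallInd_mul_one_sub_le h, smallInd_mul_one_sub_le (abs_sub_comm_le h), largeInd_mul_one_sub_le h,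
    largeInd_mul_one_sub_le (abs_sub_comm_le h)⟩

/-! ## §3 At `d = 4`: the two runs' SLOT variables under file 6's hypotheses, block-aligned cubes -/

variable {n : Type*} [Fintype n] [DecidableEq n] [Nonempty n]
  {𝒞 : ℕ → Set (B7Prop1Explicit.Site 4 → Fin 4 → (Matrix n n ℂ)ˣ)} {L N : ℕ} {θ b g C Λ₁ Λ₂' γ l₁ cg : ℝ}
  {dom : Set (B7Prop1Explicit.Site 4 → Fin 4 → (Matrix n n ℂ)ˣ)} {k : ℕ}
  {V UA UB : B7Prop1Explicit.Site 4 → Fin 4 → (Matrix n n ℂ)ˣ}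

omit [Fintype n] [DecidableEq n] [Nonempty n] in
/-- The block corner `L·x` is the stencil plaquette `(r, i, j) = (0, 0, 0)` of the coarse plaquette at `x` (`L ≥ 1`). [folklore] -/
theorem smul_eq_stencil_zero (hL : 1 ≤ L) (x : B7Prop1Explicit.Site 4) (μ ν : Fin 4) :
    (L : ℤ) • x = (L : ℤ) • x + boxVec L (fun _ => ⟨0, by omega⟩) + ((0 : ℕ) : ℤ) • e μ + ((0 : ℕ) : ℤ) • e ν := by
  have h0 : boxVec L (fun _ : Fin 4 => (⟨0, by omega⟩ : Fin L)) = 0 := by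
    funext κ; simp [boxVec]
  rw [h0]; simp

/-- **THE TWO RUNS' SLOT VARIABLES ARE CLOSE.**  HYPOTHESES: file 6's (`hcov` = N16 BY NAME, its END's side letters, `hsup : RegularSup
4 L N b cg (k+1) U_B`), a plane `π`, and a BLOCK-ALIGNED pair of nonempty finite plaquette sets — `I` (corners of the coarse plaquettes of a
cube of run A's lattice) and `J` (corners of the fine plaquettes of the same cube on run B's lattice) with `L·I ⊆ J` and the block
partner of every `w ∈ J` in `I`.  CONCLUSION: `|max_{x∈I} ‖U_A(∂p_x) − 1‖ − max_{w∈J} L²‖U_B(∂p_w) − 1‖| ≤ C_Qθ^{13k} + E_{k+1}` — run A's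
(2.17) slot variable and run B's OWN slot variable (rescaled) are as close as the plaquette variables (§1 with `σ x = L·x`,
`π w = ⌊w∕L⌋`). [folklore] -/
theorem abs_slotA_sub_slotB_le_of_n16 (hL : 2 ≤ L) (hN : 1 ≤ N) (hθ : 0 < θ) (hθ6 : θ ^ 6 = ((L : ℝ))⁻¹) (hb : 0 ≤ b)
    (hbs : 512 * (4 + 1) * (4 + 4) * (L : ℝ) ^ 2 * b ≤ 1) (hg : 0 ≤ g) (hC : 0 ≤ C) (hΛ₂' : 0 < Λ₂')
    (hcov : NE3EnergyRateWCov 4 𝒞 L N b g C Λ₁ Λ₂' dom)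
    (hγ : 0 < γ) (hγ3 : C * (wallConst 4 L * (N : ℝ) ^ 2 * (Real.sqrt g * dualC2 4 L + 2 * b ^ 2 * dualC1 4 L)) ≤ γ ^ 3)
    (hl₁ : 0 < l₁) (hΛl₁ : Λ₁ ≤ l₁ ^ 3) (hk : 1 ≤ k) (hfit : γ * (θ ^ k) ^ 2 ≤ l₁ * N) (hV : V ∈ dom)
    (hA : IsMinimiser 4 𝒞 L N k V UA) (hB : IsMinimiser 4 𝒞 L N (k + 1) V UB) (hreg : Regular 4 L N b g (k + 1) UB)
    (hsup : RegularSup 4 L N b cg (k + 1) UB) (π : Plane 4)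
    {I J : Finset (B7Prop1Explicit.Site 4)} (hI : I.Nonempty) (hJ : J.Nonempty)
    (hIJ : ∀ x ∈ I, (L : ℤ) • x ∈ J)
    (hJI : ∀ w ∈ J, ∀ (x : B7Prop1Explicit.Site 4) (r : Fin 4 → Fin L), w = (L : ℤ) • x + boxVec L r → x ∈ I) :
    |I.sup' hI (fun x => ‖((hol UA x (plaqWord π.1.1 π.1.2) : (Matrix n n ℂ)ˣ) : Matrix n n ℂ) - 1‖)
        - J.sup' hJ (fun w => (L : ℝ) ^ 2 * ‖((hol UB w (plaqWord π.1.1 π.1.2) : (Matrix n n ℂ)ˣ) : Matrix n n ℂ) - 1‖)|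
      ≤ (8 * l₁ * Real.sqrt (2 * γ * Λ₂') + 1536 * l₁ ^ 4 * γ ^ 2 * Real.exp (8 * l₁ ^ 2 * γ)) * θ ^ (13 * k)
        + ((L : ℝ) ^ 2 * (((2 * (4 * L) + 4 * L : ℕ) : ℝ)
          * (cg / ((L : ℝ) ^ (k + 1)) ^ 3 * Real.exp (2 * (b / ((L : ℝ) ^ (k + 1)) ^ 2))
            + 2 * (((3 * (4 * L) + 8 * L : ℕ) : ℝ) * (b / ((L : ℝ) ^ (k + 1)) ^ 2)) * (b / ((L : ℝ) ^ (k + 1)) ^ 2)))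
        + 226 * (8 * ((4 : ℕ) + 1 : ℝ) * ((4 : ℕ) + 4 : ℝ) * (L : ℝ) ^ 2 * (b / ((L : ℝ) ^ (k + 1)) ^ 2)) ^ 2) := by
  classical
  have hL1 : 1 ≤ L := by omega
  have hL0 : 0 < L := by omega
  -- the block partner of a fine corner (division with remainder, `exists_block_decomp`)
  let πJ : B7Prop1Explicit.Site 4 → B7Prop1Explicit.Site 4 := fun w => fun κ => w κ / (L : ℤ)
  -- closeness along `σ x = L·x` (the stencil plaquette `(0,0,0)` of the coarse plaquette at `x`)
  have hσc : ∀ x ∈ I, ‖((hol UA x (plaqWord π.1.1 π.1.2) : (Matrix n n ℂ)ˣ) : Matrix n n ℂ) - 1‖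
      ≤ (L : ℝ) ^ 2 * ‖((hol UB ((L : ℤ) • x) (plaqWord π.1.1 π.1.2) : (Matrix n n ℂ)ˣ) : Matrix n n ℂ) - 1‖
        + ((8 * l₁ * Real.sqrt (2 * γ * Λ₂') + 1536 * l₁ ^ 4 * γ ^ 2 * Real.exp (8 * l₁ ^ 2 * γ)) * θ ^ (13 * k)
        + ((L : ℝ) ^ 2 * (((2 * (4 * L) + 4 * L : ℕ) : ℝ)
          * (cg / ((L : ℝ) ^ (k + 1)) ^ 3 * Real.exp (2 * (b / ((L : ℝ) ^ (k + 1)) ^ 2))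
            + 2 * (((3 * (4 * L) + 8 * L : ℕ) : ℝ) * (b / ((L : ℝ) ^ (k + 1)) ^ 2)) * (b / ((L : ℝ) ^ (k + 1)) ^ 2)))
        + 226 * (8 * ((4 : ℕ) + 1 : ℝ) * ((4 : ℕ) + 4 : ℝ) * (L : ℝ) ^ 2 * (b / ((L : ℝ) ^ (k + 1)) ^ 2)) ^ 2)) := by
    intro x _
    have h := abs_devA_sub_scaledFine_le_of_n16 hL hN hθ hθ6 hb hbs hg hC hΛ₂' hcov hγ hγ3 hl₁ hΛl₁ hk hfit hV hA hB hreg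
      hsup x π (fun _ => ⟨0, hL0⟩) (i₀ := 0) (j₀ := 0) hL0 hL0
    rw [← smul_eq_stencil_zero hL1 x π.1.1 π.1.2] at h
    linarith [(abs_sub_le_iff.1 h).1]
  -- closeness along the block partner
  have hπc : ∀ w ∈ J, ∃ x ∈ I,
      (L : ℝ) ^ 2 * ‖((hol UB w (plaqWord π.1.1 π.1.2) : (Matrix n n ℂ)ˣ) : Matrix n n ℂ) - 1‖
        ≤ ‖((hol UA x (plaqWord π.1.1 π.1.2) : (Matrix n n ℂ)ˣ) : Matrix n n ℂ) - 1‖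
          + ((8 * l₁ * Real.sqrt (2 * γ * Λ₂') + 1536 * l₁ ^ 4 * γ ^ 2 * Real.exp (8 * l₁ ^ 2 * γ)) * θ ^ (13 * k)
          + ((L : ℝ) ^ 2 * (((2 * (4 * L) + 4 * L : ℕ) : ℝ)
            * (cg / ((L : ℝ) ^ (k + 1)) ^ 3 * Real.exp (2 * (b / ((L : ℝ) ^ (k + 1)) ^ 2))
              + 2 * (((3 * (4 * L) + 8 * L : ℕ) : ℝ) * (b / ((L : ℝ) ^ (k + 1)) ^ 2)) * (b / ((L : ℝ) ^ (k + 1)) ^ 2)))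
          + 226 * (8 * ((4 : ℕ) + 1 : ℝ) * ((4 : ℕ) + 4 : ℝ) * (L : ℝ) ^ 2 * (b / ((L : ℝ) ^ (k + 1)) ^ 2)) ^ 2)) := by
    intro w hw
    obtain ⟨x, r, hwx⟩ := exists_block_decomp hL1 w
    refine ⟨x, hJI w hw x r hwx, ?_⟩
    have h := abs_devA_sub_scaledFine_le_of_n16 hL hN hθ hθ6 hb hbs hg hC hΛ₂' hcov hγ hγ3 hl₁ hΛl₁ hk hfit hV hA hB hreg
      hsup x π r (i₀ := 0) (j₀ := 0) hL0 hL0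
    simp only [Nat.cast_zero, zero_smul, add_zero] at h
    rw [← hwx] at h
    linarith [(abs_sub_le_iff.1 h).2]
  -- §1 with the chosen partners
  rw [abs_sub_le_iff]
  constructor
  · have h : I.sup' hI (fun x => ‖((hol UA x (plaqWord π.1.1 π.1.2) : (Matrix n n ℂ)ˣ) : Matrix n n ℂ) - 1‖)
        ≤ J.sup' hJ (fun w => (L : ℝ) ^ 2 * ‖((hol UB w (plaqWord π.1.1 π.1.2) : (Matrix n n ℂ)ˣ) : Matrix n n ℂ) - 1‖)
          + ((8 * l₁ * Real.sqrt (2 * γ * Λ₂') + 1536 * l₁ ^ 4 * γ ^ 2 * Real.exp (8 * l₁ ^ 2 * γ)) * θ ^ (13 * k)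
          + ((L : ℝ) ^ 2 * (((2 * (4 * L) + 4 * L : ℕ) : ℝ)
            * (cg / ((L : ℝ) ^ (k + 1)) ^ 3 * Real.exp (2 * (b / ((L : ℝ) ^ (k + 1)) ^ 2))
              + 2 * (((3 * (4 * L) + 8 * L : ℕ) : ℝ) * (b / ((L : ℝ) ^ (k + 1)) ^ 2)) * (b / ((L : ℝ) ^ (k + 1)) ^ 2)))
          + 226 * (8 * ((4 : ℕ) + 1 : ℝ) * ((4 : ℕ) + 4 : ℝ) * (L : ℝ) ^ 2 * (b / ((L : ℝ) ^ (k + 1)) ^ 2)) ^ 2)) :=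
      Finset.sup'_le hI _ fun x hx => by
        have h1 : (L : ℝ) ^ 2 * ‖((hol UB ((L : ℤ) • x) (plaqWord π.1.1 π.1.2) : (Matrix n n ℂ)ˣ) : Matrix n n ℂ) - 1‖
            ≤ J.sup' hJ (fun w => (L : ℝ) ^ 2 * ‖((hol UB w (plaqWord π.1.1 π.1.2) : (Matrix n n ℂ)ˣ) : Matrix n n ℂ) - 1‖) :=
          Finset.le_sup' (fun w => (L : ℝ) ^ 2 *
            ‖((hol UB w (plaqWord π.1.1 π.1.2) : (Matrix n n ℂ)ˣ) : Matrix n n ℂ) - 1‖) (hIJ x hx)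
        linarith [hσc x hx]
    linarith
  · have h : J.sup' hJ (fun w => (L : ℝ) ^ 2 * ‖((hol UB w (plaqWord π.1.1 π.1.2) : (Matrix n n ℂ)ˣ) : Matrix n n ℂ) - 1‖)
        ≤ I.sup' hI (fun x => ‖((hol UA x (plaqWord π.1.1 π.1.2) : (Matrix n n ℂ)ˣ) : Matrix n n ℂ) - 1‖)
          + ((8 * l₁ * Real.sqrt (2 * γ * Λ₂') + 1536 * l₁ ^ 4 * γ ^ 2 * Real.exp (8 * l₁ ^ 2 * γ)) * θ ^ (13 * k)
          + ((L : ℝ) ^ 2 * (((2 * (4 * L) + 4 * L : ℕ) : ℝ)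
            * (cg / ((L : ℝ) ^ (k + 1)) ^ 3 * Real.exp (2 * (b / ((L : ℝ) ^ (k + 1)) ^ 2))
              + 2 * (((3 * (4 * L) + 8 * L : ℕ) : ℝ) * (b / ((L : ℝ) ^ (k + 1)) ^ 2)) * (b / ((L : ℝ) ^ (k + 1)) ^ 2)))
          + 226 * (8 * ((4 : ℕ) + 1 : ℝ) * ((4 : ℕ) + 4 : ℝ) * (L : ℝ) ^ 2 * (b / ((L : ℝ) ^ (k + 1)) ^ 2)) ^ 2)) :=
      Finset.sup'_le hJ _ fun w hw => by
        obtain ⟨x, hx, hle⟩ := hπc w hw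
        have h1 : ‖((hol UA x (plaqWord π.1.1 π.1.2) : (Matrix n n ℂ)ˣ) : Matrix n n ℂ) - 1‖
            ≤ I.sup' hI (fun x => ‖((hol UA x (plaqWord π.1.1 π.1.2) : (Matrix n n ℂ)ˣ) : Matrix n n ℂ) - 1‖) :=
          Finset.le_sup' (fun x => ‖((hol UA x (plaqWord π.1.1 π.1.2) : (Matrix n n ℂ)ˣ) : Matrix n n ℂ) - 1‖) hx
        linarith
    linarith

/-- **SLOT-LEVEL SHELL DOMINATION AT RUN B's OWN SLOT TEST.**  Under the hypotheses of `abs_slotA_sub_slotB_le_of_n16`, for every threshold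
`t` and every width `δ ≥ C_Qθ^{13k} + E_{k+1}`: with `s^A = max_{x∈I} ‖U_A(∂p_x) − 1‖` (run A's (2.17) slot variable) and `s^B = max_{w∈J}
‖U_B(∂p_w) − 1‖` (run B's OWN slot variable, tested at `t∕L²`), the mismatch «A's slot small at `t`, B's slot NOT small at `t∕L²`» lies in run A's
shell below `t` of `s^A`; «B small, A not» in the shell below `t` of `L²s^B`; and the two large-field polarities in the shells above. [folklore] -/
theorem slot_shell_domination_of_n16 (hL : 2 ≤ L) (hN : 1 ≤ N) (hθ : 0 < θ) (hθ6 : θ ^ 6 = ((L : ℝ))⁻¹) (hb : 0 ≤ b)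
    (hbs : 512 * (4 + 1) * (4 + 4) * (L : ℝ) ^ 2 * b ≤ 1) (hg : 0 ≤ g) (hC : 0 ≤ C) (hΛ₂' : 0 < Λ₂')
    (hcov : NE3EnergyRateWCov 4 𝒞 L N b g C Λ₁ Λ₂' dom)
    (hγ : 0 < γ) (hγ3 : C * (wallConst 4 L * (N : ℝ) ^ 2 * (Real.sqrt g * dualC2 4 L + 2 * b ^ 2 * dualC1 4 L)) ≤ γ ^ 3)
    (hl₁ : 0 < l₁) (hΛl₁ : Λ₁ ≤ l₁ ^ 3) (hk : 1 ≤ k) (hfit : γ * (θ ^ k) ^ 2 ≤ l₁ * N) (hV : V ∈ dom)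
    (hA : IsMinimiser 4 𝒞 L N k V UA) (hB : IsMinimiser 4 𝒞 L N (k + 1) V UB) (hreg : Regular 4 L N b g (k + 1) UB)
    (hsup : RegularSup 4 L N b cg (k + 1) UB) (π : Plane 4)
    {I J : Finset (B7Prop1Explicit.Site 4)} (hI : I.Nonempty) (hJ : J.Nonempty)
    (hIJ : ∀ x ∈ I, (L : ℤ) • x ∈ J)
    (hJI : ∀ w ∈ J, ∀ (x : B7Prop1Explicit.Site 4) (r : Fin 4 → Fin L), w = (L : ℤ) • x + boxVec L r → x ∈ I) (t : ℝ) :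
    ∀ δ : ℝ, (8 * l₁ * Real.sqrt (2 * γ * Λ₂') + 1536 * l₁ ^ 4 * γ ^ 2 * Real.exp (8 * l₁ ^ 2 * γ)) * θ ^ (13 * k)
        + ((L : ℝ) ^ 2 * (((2 * (4 * L) + 4 * L : ℕ) : ℝ)
          * (cg / ((L : ℝ) ^ (k + 1)) ^ 3 * Real.exp (2 * (b / ((L : ℝ) ^ (k + 1)) ^ 2))
            + 2 * (((3 * (4 * L) + 8 * L : ℕ) : ℝ) * (b / ((L : ℝ) ^ (k + 1)) ^ 2)) * (b / ((L : ℝ) ^ (k + 1)) ^ 2)))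
        + 226 * (8 * ((4 : ℕ) + 1 : ℝ) * ((4 : ℕ) + 4 : ℝ) * (L : ℝ) ^ 2 * (b / ((L : ℝ) ^ (k + 1)) ^ 2)) ^ 2) ≤ δ →
    smallInd (I.sup' hI fun x => ‖((hol UA x (plaqWord π.1.1 π.1.2) : (Matrix n n ℂ)ˣ) : Matrix n n ℂ) - 1‖) t
        * (1 - smallInd (J.sup' hJ fun w => ‖((hol UB w (plaqWord π.1.1 π.1.2) : (Matrix n n ℂ)ˣ) : Matrix n n ℂ) - 1‖)
            (t / (L : ℝ) ^ 2))
        ≤ shellBelow (I.sup' hI fun x => ‖((hol UA x (plaqWord π.1.1 π.1.2) : (Matrix n n ℂ)ˣ) : Matrix n n ℂ) - 1‖) t δ ∧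
      smallInd (J.sup' hJ fun w => ‖((hol UB w (plaqWord π.1.1 π.1.2) : (Matrix n n ℂ)ˣ) : Matrix n n ℂ) - 1‖) (t / (L : ℝ) ^ 2)
        * (1 - smallInd (I.sup' hI fun x => ‖((hol UA x (plaqWord π.1.1 π.1.2) : (Matrix n n ℂ)ˣ) : Matrix n n ℂ) - 1‖) t)
        ≤ shellBelow (J.sup' hJ fun w => (L : ℝ) ^ 2 *
            ‖((hol UB w (plaqWord π.1.1 π.1.2) : (Matrix n n ℂ)ˣ) : Matrix n n ℂ) - 1‖) t δ ∧
      largeInd (I.sup' hI fun x => ‖((hol UA x (plaqWord π.1.1 π.1.2) : (Matrix n n ℂ)ˣ) : Matrix n n ℂ) - 1‖) t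
        * (1 - largeInd (J.sup' hJ fun w => ‖((hol UB w (plaqWord π.1.1 π.1.2) : (Matrix n n ℂ)ˣ) : Matrix n n ℂ) - 1‖)
            (t / (L : ℝ) ^ 2))
        ≤ shellAbove (I.sup' hI fun x => ‖((hol UA x (plaqWord π.1.1 π.1.2) : (Matrix n n ℂ)ˣ) : Matrix n n ℂ) - 1‖) t δ ∧
      largeInd (J.sup' hJ fun w => ‖((hol UB w (plaqWord π.1.1 π.1.2) : (Matrix n n ℂ)ˣ) : Matrix n n ℂ) - 1‖) (t / (L : ℝ) ^ 2)
        * (1 - largeInd (I.sup' hI fun x => ‖((hol UA x (plaqWord π.1.1 π.1.2) : (Matrix n n ℂ)ˣ) : Matrix n n ℂ) - 1‖) t)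
        ≤ shellAbove (J.sup' hJ fun w => (L : ℝ) ^ 2 *
            ‖((hol UB w (plaqWord π.1.1 π.1.2) : (Matrix n n ℂ)ˣ) : Matrix n n ℂ) - 1‖) t δ := by
  intro δ hδ
  have hL2 : (0 : ℝ) < (L : ℝ) ^ 2 := by
    have : (0 : ℝ) < L := by exact_mod_cast (by omega : 0 < L)
    positivity
  have h := (abs_slotA_sub_slotB_le_of_n16 hL hN hθ hθ6 hb hbs hg hC hΛ₂' hcov hγ hγ3 hl₁ hΛl₁ hk hfit hV hA hB hreg hsup π
    hI hJ hIJ hJI).trans hδ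
  rw [smallInd_sup'_scaled hJ _ hL2, largeInd_sup'_scaled hJ _ hL2]
  exact ⟨smallInd_mul_one_sub_le h, smallInd_mul_one_sub_le (abs_sub_comm_le h), largeInd_mul_one_sub_le h,
    largeInd_mul_one_sub_le (abs_sub_comm_le h)⟩

end Summit.QuantumFields.YangMills.Theorems.N21SlotSupJunction

end
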